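import Literature.IUT.HodgeArakelov.ThetaEvaluationModelEvDiagramIsmOrbit
import Literature.IUT.HodgeArakelov.ThetaEvaluationModelEvOfTower

/-!
# [IUTchII] Cor 1.12 (ii) AND (iii) at the model `Π = Π^tp_X̲̲` for ONE theta-evaluation datum — cyclotomic rigidity datum
# `cU` from the cyclotome tower, last arrow of `(†μ,×μ)` = the GENUINE `Ism(G)`-orbit (proof companion, closing composition)

Proof-only closing composition (abc-iut cell, D-0067 wave 4, seat abc-iut-w4-d043 gen 3; nodes **IUTchII:Cor1.12(ii)**,
**IUTchII:Cor1.12(iii)**) of abc-iut-w4-d007's `ThetaEvaluationModelEvOfTower.lean` (`cor112_ii_model_of_cyclotomeTower`,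
p425297: Cor. 1.12 (ii) at the model with `hfix`/`hcU`/`hlift`/`hemb`/`hμ` gone), abc-iut-w4-d043's
`ThetaEvaluationModelEvDiagram(Genuine).lean` (p425654/p427441: the diagram `(†μ,×μ)` at the model with the `α_×`-induced last
arrow) and abc-iut-L6-d2's `ThetaEvaluationModelEvDiagramIsmOrbit.lean` (`cor112_iii_model_genuineIsm_of_tower`: its
`Γ^{×μ} = Ism(G)`-orbit over the FULLY GENUINE producer `genuineOfModelIsm`).  The (iii)-only twins with `cU` from the tower are
abc-iut-w4-d007's `ThetaEvaluationModelEvDiagram(Genuine)OfTower.lean`; THIS file binds (ii) and (iii) to ONE datum (one `cU`).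
No definition, no `Prop`-valued fact; nothing of those files is restated.

S. Mochizuki, *Inter-universal Teichmüller theory II*, kurims manuscript (Dec. 2020), Cor. 1.12 (ii), (iii) pp. 56–58
[claim: Mochizuki2012, status: disputed] (IUTchII §1 Cor 1.12, kurims pp.56-58).  Claim key DISPUTED (D-0012); nothing here
takes a side on [IUTchIII] Cor. 3.12.

PROVED: `EtaleLevels.cor112_model_of_cyclotomeTower` — for the model theta-evaluation datum `(†×θ)(Π)` of record
(abc-iut-w4-d043 `EtaleLevels.thetaEvaluation` over abc-iut-w4-d030's `θ_env`-data, REAL continuous cohomology of `(l·Δ_Θ)`,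
the MODEL POINTED INVERSION `pointedInversionOfPair` of abc-iut-w5-d072, the canonical retractions of `ε` from "`D_{μ_-}`
compact", constants `ℚ̄_pˣ ⊇ 𝒪^×_{ℚ̄_p}` through `ε`, `iotaLim := pairRhoLim (α, β)`) THERE IS a bijective change of
coefficient cyclotome `cU : Λ(ℚ̄_pˣ) ⥲ l·Δ_Θ`, inverse to the model's own identifications (`(mods M).red (cU ζ) = ζ_M`), such
that, for the datum built with it, BOTH the typed Cor. 1.12 (ii) `Cor112_ii` (splittings `(†μθ)(Π)`) AND the typed Cor. 1.12
(iii) diagram `(†μ,×μ)` (`MuXmuDiagram`, over the FULLY GENUINE [AbsTopIII]-output data `genuineOfModelIsm` of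
abc-iut-L6-t13/L6-d2 on the MLF closure datum `(k, ℚ̄_p)` — `O^⊳ = 𝒪^⊳_{ℚ̄_p}`, `Ism(G) =` print's group of `G`-isometries —,
`Q :=` the torsion of `lim_J H¹(Π_Ÿ(M^Θ_*)|_J, Π_μ(M^Θ_*))`, last arrow `=` the `Ism(G)`-ORBIT of the `α_×`-induced
identifications after the inverse Kummer identification) HOLD.  Residual NAMED inputs: the Rmk. 1.4.1 (ii) data of the pointed inversion
(`α … hstd`), `β`/`hφ`/`hAβ`/`hH`, `hα`/`hβ`, the decomposition-group facts `hDq`/`hDc`/`[(D_{μ_-}.map ε).FiniteIndex]`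
([SemiAnbd] §6), `[T2Space G_{ℚ_p}]`, the Prop. 2.2 (ii) translate inputs `τ`/`hτ`/`hdesc`/`hrev`/`hfree`, `hO : IsEtThOrigin`
(F-2498), `hΔΘ : IsCompact Δ_Θ` (G-w5d187-1), and the [AbsTopIII] producer's `ε : G_k ≅ Gal(ℚ̄_p/k)` / (H1) `hΔX` / (H2)
`hq` for an MLF `k ⊆ ℚ̄_p` finite over `ℚ_p`.  Typed ≠ proved for those; instantiated ≠ endorsed.
-/

noncomputable section

namespace Literature.IUT.HodgeArakelov

open Literature.AnabelianGeometry.EtaleTheta Literature.AnabelianGeometry.SemiGraphs CohomologySystemOfContH1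
open Literature.AnabelianGeometry.AbsoluteAnabelian
open scoped Literature.AnabelianGeometry.EtaleTheta

namespace EtaleLevels

variable {p : ℕ} [Fact p.Prime] {D : Literature.AnabelianGeometry.EtaleTheta.ThetaSetting p}
  {E : D.EtaleThetaData} {l : ℕ} (C : E.DoubleUnderline l) (hC : D.Compat) (hS : D.Sec2Hyps)
  (hl : l.Prime) (hp2 : p ≠ 2) (hpl : p ≠ l) (hζ : ∃ ζ : D.K, IsPrimitiveRoot ζ (4 * l))
  (mods : ∀ M : ℕ+, D.CyclotomeMod l M)
  (f : contCocycles D.toTheta D.DeltaTheta C.GtpYdduu) (hf : f ∈ C.rootCocycles hC)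
  (hmods : ∀ (M M' : ℕ+) (h : (M : ℕ) ∣ (M' : ℕ)) (x : D.lDeltaTheta l),
    MuN.red p M M' h ((mods M').red x) = (mods M).red x)
  (h15 : Literature.AnabelianGeometry.EtaleTheta.ThetaSetting.Prop15iii E hC) (L : C.CuspLabels)
  (hZ : ∀ M : ℕ+, Nonempty (ModelCyclotomes.lDeltaQuot (C.rigidData (mods M) hC hS h15 L) ≃*
    Literature.IUT.HodgeTheaters.ZHat))
  (hcharY : EtaleThetaDataOfSetting.PiYddCharacteristic C)
  (hlim : Function.Bijective (rigidLimHom C hC hS hl hp2 hpl hζ mods f hf hmods h15 L hZ))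
  (Env : EnvOfGroup (setting C hC hS hl hp2 hpl hζ mods f hf)
    (modelSystem C hC hS hl hp2 hpl hζ mods f hf hmods h15 L hZ).PiX)
  -- the model pointed inversion (abc-iut-w5-d072's `pointedInversionOfPair`): its named print inputs
  (α : (EtaleThetaDataOfSetting.Pi C) ≃ₜ* (EtaleThetaDataOfSetting.Pi C))
  (hover : ∀ x : EtaleThetaDataOfSetting.Pi C, Env.recon.projG (Env.isoX (α x)) = Env.recon.projG (Env.isoX x))
  (δ : EtaleThetaDataOfSetting.Pi C) (hδ : Env.recon.projG (Env.isoX δ) = 1)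
  (hαα : ∀ x : EtaleThetaDataOfSetting.Pi C, α (α x) = δ * x * δ⁻¹)
  (γ : EtaleThetaDataOfSetting.Pi C) (hγ : C.toLZ γ = Multiplicative.ofAdd 1)
  (hαγ : C.toLZ (α γ) = Multiplicative.ofAdd (-1))
  (huniq : ∀ κ : (EtaleThetaDataOfSetting.Pi C) ≃ₜ* (EtaleThetaDataOfSetting.Pi C),
    (∀ x, Env.recon.projG (Env.isoX (κ x)) = Env.recon.projG (Env.isoX x)) →
    (∃ δ' : EtaleThetaDataOfSetting.Pi C, Env.recon.projG (Env.isoX δ') = 1 ∧ ∀ x, κ (κ x) = δ' * x * δ'⁻¹) →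
    (¬ ∃ δ' : EtaleThetaDataOfSetting.Pi C, Env.recon.projG (Env.isoX δ') = 1 ∧ ∀ x, κ x = δ' * x * δ'⁻¹) →
      ∃ δ' : EtaleThetaDataOfSetting.Pi C, Env.recon.projG (Env.isoX δ') = 1 ∧ ∀ x, κ x = δ' * α x * δ'⁻¹)
  (Dmu : Subgroup (EtaleThetaDataOfSetting.Pi C)) (hDmu : Dmu ≤ EtaleThetaDataOfSetting.PiYdd C)
  (hfixD : ∃ δ' : ↥(EtaleThetaDataOfSetting.PiYdd C), Env.recon.projG (Env.isoX (δ' : EtaleThetaDataOfSetting.Pi C)) = 1 ∧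
    ∀ (d : EtaleThetaDataOfSetting.Pi C) (hd : d ∈ Dmu), ((EtaleThetaDataOfSetting.iotaYddOfAut C hcharY α ⟨d, hDmu hd⟩ :
      EtaleThetaDataOfSetting.PiYdd C) : EtaleThetaDataOfSetting.Pi C) ∈
        Dmu.map (MulAut.conj ((δ' : EtaleThetaDataOfSetting.PiYdd C) : EtaleThetaDataOfSetting.Pi C)).toMonoidHom)
  (etaStd : (EtaleThetaDataOfSetting.coh C).H1 ⊤) (hmem : etaStd ∈ EtaleThetaDataOfSetting.orbitOne C hC)
  (hstd : (2 * (setting C hC hS hl hp2 hpl hζ mods f hf).l) • EtaleThetaDataOfSetting.resDmuOf C Dmu hDmu etaStd = 0)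
  -- the coefficient half of the pair and its printed properties
  (β : D.GtpTheta ≃ₜ* D.GtpTheta)
  (hφ : ∀ g, β (EtaleThetaDataOfSetting.phi C g) = EtaleThetaDataOfSetting.phi C (α g))
  (hAβ : ∀ a : D.GtpTheta, a ∈ D.lDeltaTheta l ↔ β a ∈ D.lDeltaTheta l)
  (hH : ∀ x, x ∈ EtaleThetaDataOfSetting.PiYdd C ↔ α x ∈ EtaleThetaDataOfSetting.PiYdd C)
  -- decomposition-group facts
  (hDq : ∀ d ∈ Dmu, EtaleThetaDataOfSetting.aug C d = 1 → d = 1)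
  (hDc : IsCompact (Dmu : Set (EtaleThetaDataOfSetting.Pi C)))
  -- the GENUINE [AbsTopIII]-output data: base MLF `k ⊆ ℚ̄_p` (finite over `ℚ_p`, `k̄ = ℚ̄_p`), model identification `ε`,
  -- (H1) `Δ` characteristic, (H2) `Π/Δ ≅ G_k`
  (k : Type) [Field k] [ValuativeRel k] [TopologicalSpace k] [IsNonarchimedeanLocalField k] [CharZero k]
  [Algebra k (PadicAlgCl p)] [IsAlgClosure k (PadicAlgCl p)]
  [Algebra ℚ_[p] k] [FiniteDimensional ℚ_[p] k] [IsScalarTower ℚ_[p] k (PadicAlgCl p)]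
  (ε : (setting C hC hS hl hp2 hpl hζ mods f hf).Gk ≃ₜ*
    (ModelMLFGaloisData.galois ({ k := k, K := PadicAlgCl p } : MLFClosure.{0}).k
      ({ k := k, K := PadicAlgCl p } : MLFClosure.{0}).K).tmPair.Pi)
  (hΔX : ∀ φ : (setting C hC hS hl hp2 hpl hζ mods f hf).PiX ≃ₜ* (setting C hC hS hl hp2 hpl hζ mods f hf).PiX,
    (setting C hC hS hl hp2 hpl hζ mods f hf).DeltaX.map φ.toMulEquiv.toMonoidHom =
      (setting C hC hS hl hp2 hpl hζ mods f hf).DeltaX)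
  (hq : Nonempty (TopGroup.quot (setting C hC hS hl hp2 hpl hζ mods f hf).PiX (setting C hC hS hl hp2 hpl hζ mods f hf).DeltaX ≃ₜ*
    (setting C hC hS hl hp2 hpl hζ mods f hf).Gk))

/-- **[IUTchII] Cor 1.12 (ii) and (iii) at the model `Π := Π^tp_X̲̲`, for ONE theta-evaluation datum, with the cyclotomic
rigidity datum `cU` and its bijectivity DISCHARGED and the last arrow of `(†μ,×μ)` the GENUINE `Ism(G)`-orbit.** THERE IS a bijective change of coefficient cyclotome
`cU : Λ(ℚ̄_pˣ) = Ẑ(1) ⥲ l·Δ_Θ` — inverse to the model's identifications, `(mods M).red (cU ζ) = ζ_M` (abc-iut-w4-d007's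
`exists_cyclotomeCoefficients_of_cyclotomeTower`, unique by `eq_of_forall_modAll_red_eq`) — such that for the model datum
`(†×θ)(Π)` built with it (model pointed inversion, canonical retractions of `ε`, constants `𝒪^×_{ℚ̄_p} ⊆ ℚ̄_pˣ` through `ε`,
`iotaLim := pairRhoLim (α, β)`): (ii) the typed `Cor112_ii` — the splittings `(†μθ)(Π)` — HOLDS (abc-iut-w4-d007
`cor112_ii_model_of_cyclotomeTower` over `cor112_ii_model_unitGroup`), and (iii) the typed diagram `(†μ,×μ)` EXISTS over
the FULLY GENUINE [AbsTopIII]-output data `genuineOfModelIsm` (abc-iut-L6-t13/L6-d2) on `(k, ℚ̄_p)`, with `Q :=` the torsion of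
`lim_J H¹(Π_Ÿ(M^Θ_*)|_J, Π_μ(M^Θ_*))`, `κ :=` its inclusion, and last arrow `poly₄₅ =` {`e` | for some member `f : Π/Δ ⥲ G` of
the full poly-isomorphism and some `G`-isometry `gI ∈ Ism(G)`, `e` carries the class of the Kummer class `κ_D u` of every unit
`u ∈ 𝒪^×_{ℚ̄_p}` to `gI ·` the class of THE lift to `𝒪^⊳_{ℚ̄_p}` of the Galois automorphism induced by `f`, applied to `u`}
(abc-iut-L6-d2 `cor112_iii_model_genuineIsm_of_tower` over abc-iut-w4-d043 `cor112_iii_model_of_unitsEquiv`). Residual named inputs: the Rmk. 1.4.1 (ii) data `α … hstd`, `β`/`hφ`/`hAβ`/`hH`,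
`hα`/`hβ`, `hDq`/`hDc`/`[(D_{μ_-}.map ε).FiniteIndex]`, `[T2Space G_{ℚ_p}]`, `τ`/`hτ`/`hdesc`/`hrev`/`hfree`, `hO` (F-2498),
`hΔΘ` (G-w5d187-1), the producer's `ε`/(H1) `hΔX`/(H2) `hq`.
[claim: Mochizuki2012, status: disputed] (IUTchII §1 Cor 1.12 (ii)(iii), kurims pp.56-58) -/
theorem cor112_model_of_cyclotomeTower [T2Space (GQp p)] [(Dmu.map (EtaleThetaDataOfSetting.aug C)).FiniteIndex]
    (hO : D.IsEtThOrigin) (hΔΘ : IsCompact (D.DeltaTheta : Set D.GtpTheta))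
    (hα : ∀ x, EtaleThetaDataOfSetting.aug C (α x) = EtaleThetaDataOfSetting.aug C x)
    (hβ : ∀ a : D.GtpTheta, a ∈ D.lDeltaTheta l → β a = a)
    (τ : ℤ → (EtaleThetaDataOfSetting.coh C).H1 ⊤) (hτ : τ 0 = etaStd)
    (hdesc : ∀ o ∈ EtaleThetaDataOfSetting.orbitOne C hC,
      ∃ (n : ℤ) (c' : (EtaleThetaDataOfSetting.coh C).H1 ⊤), 2 • c' = 0 ∧ o = τ n + c')
    (hrev : ∀ n : ℤ, IsOfFinAddOrder (EtaleThetaDataOfSetting.pairRho C α β hφ hAβ hH (τ n) - τ (-n)))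
    (hfree : ∀ m n : ℤ, IsOfFinAddOrder (τ m - τ n) → m = n)
    (G : IsoClass (setting C hC hS hl hp2 hpl hζ mods f hf).Gk) :
    ∃ cU : CyclotomeCoefficients (EtaleThetaDataOfSetting.phi C) (D.lDeltaTheta l) (PadicAlgCl p)ˣ,
      Function.Bijective cU.hom ∧
      (∀ (ζ : Literature.AnabelianGeometry.EtaleTheta.cyclotome (PadicAlgCl p)ˣ) (M : ℕ+),
        (((mods M).red (cU.hom ζ) : MuN p M) : (PadicAlgCl p)ˣ) = (ζ : ℕ+ → (PadicAlgCl p)ˣ) M) ∧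
      Literature.IUT.HodgeArakelov.Cor112_ii
        (thetaEvaluation C hC hS hl hp2 hpl hζ mods f hf hmods h15 L hZ hcharY hlim Env
          (EtaleThetaDataOfSetting.pointedInversionOfPair C hC hS hcharY (setting C hC hS hl hp2 hpl hζ mods f hf)
            (ContinuousMulEquiv.refl _) rfl Env α hover δ hδ hαα γ hγ hαγ huniq Dmu hDmu hfixD etaStd hmem hstd)
          (LevelRetraction.ofAugmentation (EtaleThetaDataOfSetting.phi C) (D.lDeltaTheta l)
            (EtaleThetaDataOfSetting.aug C) Dmu hDq (EtaleThetaDataOfSetting.PiYdd C)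
            (EtaleThetaDataOfSetting.continuous_aug C) (aug_ker_acts_trivially C)
            (hlift_of_isCompact (EtaleThetaDataOfSetting.aug C) Dmu (EtaleThetaDataOfSetting.continuous_aug C) hDc)
            (hemb_of_isCompact (EtaleThetaDataOfSetting.aug C) Dmu (EtaleThetaDataOfSetting.continuous_aug C) hDc hDq))
          cU (EtaleThetaDataOfSetting.isOpen_stabilizer_units C) (EtaleThetaDataOfSetting.finiteIndex_stabilizer_units C)
          (unitGroup ℚ_[p] (PadicAlgCl p)) (EtaleThetaDataOfSetting.pairRhoLim C α β hφ hAβ hH)) ∧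
      ∃ Δ : MuXmuDiagram
          (thetaEvaluation C hC hS hl hp2 hpl hζ mods f hf hmods h15 L hZ hcharY hlim Env
            (EtaleThetaDataOfSetting.pointedInversionOfPair C hC hS hcharY (setting C hC hS hl hp2 hpl hζ mods f hf)
              (ContinuousMulEquiv.refl _) rfl Env α hover δ hδ hαα γ hγ hαγ huniq Dmu hDmu hfixD etaStd hmem hstd)
            (LevelRetraction.ofAugmentation (EtaleThetaDataOfSetting.phi C) (D.lDeltaTheta l)
              (EtaleThetaDataOfSetting.aug C) Dmu hDq (EtaleThetaDataOfSetting.PiYdd C)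
              (EtaleThetaDataOfSetting.continuous_aug C) (aug_ker_acts_trivially C)
              (hlift_of_isCompact (EtaleThetaDataOfSetting.aug C) Dmu (EtaleThetaDataOfSetting.continuous_aug C) hDc)
              (hemb_of_isCompact (EtaleThetaDataOfSetting.aug C) Dmu (EtaleThetaDataOfSetting.continuous_aug C) hDc hDq))
            cU (EtaleThetaDataOfSetting.isOpen_stabilizer_units C) (EtaleThetaDataOfSetting.finiteIndex_stabilizer_units C)
            (unitGroup ℚ_[p] (PadicAlgCl p)) (EtaleThetaDataOfSetting.pairRhoLim C α β hφ hAβ hH))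
          (AbsTopMonoids.genuineOfModelIsm (setting C hC hS hl hp2 hpl hζ mods f hf) { k := k, K := PadicAlgCl p } ε hΔX hq) G
          ↥(AddCommGroup.torsion (thetaEnvData C hC hS hl hp2 hpl hζ mods f hf hmods h15 L hZ hcharY hlim).cohEnv.lim)
          (AddCommGroup.torsion (thetaEnvData C hC hS hl hp2 hpl hζ mods f hf hmods h15 L hZ hcharY hlim).cohEnv.lim).subtype,
        Δ.poly₄₅ = {e | ∃ (φ : AbsTopMonoids.Genuine.qObj hq (IsoClass.base (setting C hC hS hl hp2 hpl hζ mods f hf).PiX) ⟶ G)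
            (gI : (AbsTopMonoids.genuineOfModelIsm (setting C hC hS hl hp2 hpl hζ mods f hf) { k := k, K := PadicAlgCl p }
              ε hΔX hq).Ism G),
          ∀ (u : ↥(unitGroup ℚ_[p] (PadicAlgCl p)))
            (m : ↥(thetaEvaluation C hC hS hl hp2 hpl hζ mods f hf hmods h15 L hZ hcharY hlim Env
              (EtaleThetaDataOfSetting.pointedInversionOfPair C hC hS hcharY (setting C hC hS hl hp2 hpl hζ mods f hf)
                (ContinuousMulEquiv.refl _) rfl Env α hover δ hδ hαα γ hγ hαγ huniq Dmu hDmu hfixD etaStd hmem hstd)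
              (LevelRetraction.ofAugmentation (EtaleThetaDataOfSetting.phi C) (D.lDeltaTheta l)
                (EtaleThetaDataOfSetting.aug C) Dmu hDq (EtaleThetaDataOfSetting.PiYdd C)
                (EtaleThetaDataOfSetting.continuous_aug C) (aug_ker_acts_trivially C)
                (hlift_of_isCompact (EtaleThetaDataOfSetting.aug C) Dmu (EtaleThetaDataOfSetting.continuous_aug C) hDc)
                (hemb_of_isCompact (EtaleThetaDataOfSetting.aug C) Dmu (EtaleThetaDataOfSetting.continuous_aug C) hDc hDq))
              cU (EtaleThetaDataOfSetting.isOpen_stabilizer_units C) (EtaleThetaDataOfSetting.finiteIndex_stabilizer_units C)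
              (unitGroup ℚ_[p] (PadicAlgCl p)) (EtaleThetaDataOfSetting.pairRhoLim C α β hφ hAβ hH)).MxTM)
            (w : (nonzeroIntegers k (PadicAlgCl p))ˣ),
            (m : (thetaEvaluation C hC hS hl hp2 hpl hζ mods f hf hmods h15 L hZ hcharY hlim Env
              (EtaleThetaDataOfSetting.pointedInversionOfPair C hC hS hcharY (setting C hC hS hl hp2 hpl hζ mods f hf)
                (ContinuousMulEquiv.refl _) rfl Env α hover δ hδ hαα γ hγ hαγ huniq Dmu hDmu hfixD etaStd hmem hstd)
              (LevelRetraction.ofAugmentation (EtaleThetaDataOfSetting.phi C) (D.lDeltaTheta l)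
                (EtaleThetaDataOfSetting.aug C) Dmu hDq (EtaleThetaDataOfSetting.PiYdd C)
                (EtaleThetaDataOfSetting.continuous_aug C) (aug_ker_acts_trivially C)
                (hlift_of_isCompact (EtaleThetaDataOfSetting.aug C) Dmu (EtaleThetaDataOfSetting.continuous_aug C) hDc)
                (hemb_of_isCompact (EtaleThetaDataOfSetting.aug C) Dmu (EtaleThetaDataOfSetting.continuous_aug C) hDc hDq))
              cU (EtaleThetaDataOfSetting.isOpen_stabilizer_units C) (EtaleThetaDataOfSetting.finiteIndex_stabilizer_units C)
              (unitGroup ℚ_[p] (PadicAlgCl p)) (EtaleThetaDataOfSetting.pairRhoLim C α β hφ hAβ hH)).Hd) =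
                Multiplicative.toAdd (h1LimKummer (EtaleThetaDataOfSetting.phi C) (D.lDeltaTheta l) Dmu cU
                  (EtaleThetaDataOfSetting.isOpen_stabilizer_units C) (EtaleThetaDataOfSetting.finiteIndex_stabilizer_units C) u) →
            ((w : nonzeroIntegers k (PadicAlgCl p)) : PadicAlgCl p) = ((u : (PadicAlgCl p)ˣ) : PadicAlgCl p) →
              e (Multiplicative.ofAdd (QuotientAddGroup.mk m)) =
                (AbsTopMonoids.genuineOfModelIsm (setting C hC hS hl hp2 hpl hζ mods f hf) { k := k, K := PadicAlgCl p }
                    ε hΔX hq).actIsm G gI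
                  (QuotientGroup.mk (Units.map (AbsTopMonoids.Genuine.liftM ({ k := k, K := PadicAlgCl p } : MLFClosure.{0})
                    (AbsTopMonoids.Genuine.phiOf ({ k := k, K := PadicAlgCl p } : MLFClosure.{0}) ε φ)).toMonoidHom w))} := by
  obtain ⟨cU, hcU, hlev, hii⟩ := cor112_ii_model_of_cyclotomeTower C hC hS hl hp2 hpl hζ mods f hf hmods h15 L hZ hcharY hlim
    Env α hover δ hδ hαα γ hγ hαγ huniq Dmu hDmu hfixD etaStd hmem hstd β hφ hAβ hH hDq hDc hO hΔΘ hα hβ τ hτ hdesc hrev hfree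
  -- the finite-index instance, read on the pointed inversion's `Dmu` (definitionally the given `Dmu`)
  haveI : (Subgroup.map (EtaleThetaDataOfSetting.aug C)
      (EtaleThetaDataOfSetting.pointedInversionOfPair C hC hS hcharY (setting C hC hS hl hp2 hpl hζ mods f hf)
        (ContinuousMulEquiv.refl _) rfl Env α hover δ hδ hαα γ hγ hαγ huniq Dmu hDmu hfixD etaStd hmem hstd).Dmu).FiniteIndex :=
    ‹(Dmu.map (EtaleThetaDataOfSetting.aug C)).FiniteIndex›
  exact ⟨cU, hcU, hlev, hii,
    cor112_iii_model_genuineIsm_of_tower C hC hS hl hp2 hpl hζ mods f hf hmods h15 L hZ hcharY hlim Env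
      (EtaleThetaDataOfSetting.pointedInversionOfPair C hC hS hcharY (setting C hC hS hl hp2 hpl hζ mods f hf)
        (ContinuousMulEquiv.refl _) rfl Env α hover δ hδ hαα γ hγ hαγ huniq Dmu hDmu hfixD etaStd hmem hstd)
      hDq _ _ cU _ k ε hΔX hq hcU G⟩

end EtaleLevels

end Literature.IUT.HodgeArakelov

end
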